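import Mathlib

/-!
# SoloBlind kernel #212 — Pincherle domination: the backward continued-fraction step is a `1/8`-contraction

The block-Weyl data of LEMMA R (A8-CAP, regime (I)) are computed by the backward Riccati recursion
`r_m = -c_m / (b_m + a_m r_{m+1})` started deep in the absorption-dominated region, where
`2 (‖a_m‖ + ‖c_m‖) ≤ ‖b_m‖` (the diagonal `ε K₀ m²` dominates the hopping).  This file certifies the
scalar tail control used to truncate the recursion: under domination the step maps the closed unit ball
into the ball of radius `1/2`, and it contracts by the factor `1/8` there
(`‖a‖‖c‖ ≤ (‖a‖ + 2‖c‖)²/8`), so starting values anywhere in the unit ball agree after `k` dominated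
steps to within `2 · 8^{-k}`.
-/

namespace Summit.AnomalousDissipation.AnomalousDissipation.Theorems

/-- The continued-fraction step `r ↦ -c / (b + a r)`. -/
noncomputable def cfStep (a b c r : ℂ) : ℂ := -c / (b + a * r)

/-- Under domination `2(‖a‖ + ‖c‖) ≤ ‖b‖` and `‖r‖ ≤ 1`, the denominator is bounded below:
`‖a‖ + 2‖c‖ ≤ ‖b + a r‖`. -/
theorem cf_denom_lower (a b c r : ℂ) (hdom : 2 * (‖a‖ + ‖c‖) ≤ ‖b‖) (hr : ‖r‖ ≤ 1) :
    ‖a‖ + 2 * ‖c‖ ≤ ‖b + a * r‖ := by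
  have h1 : ‖b‖ ≤ ‖b + a * r‖ + ‖a * r‖ := by
    have := norm_sub_le (b + a * r) (a * r)
    simp only [add_sub_cancel_right] at this
    exact this
  have h2 : ‖a * r‖ ≤ ‖a‖ := by
    rw [norm_mul]
    exact mul_le_of_le_one_right (norm_nonneg a) hr
  linarith

/-- Invariance: the dominated step maps the unit ball into the ball of radius `1/2`. -/
theorem cfStep_norm_le_half (a b c r : ℂ) (hdom : 2 * (‖a‖ + ‖c‖) ≤ ‖b‖) (hr : ‖r‖ ≤ 1) :
    ‖cfStep a b c r‖ ≤ 1 / 2 := by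
  unfold cfStep
  have hden := cf_denom_lower a b c r hdom hr
  by_cases hc : c = 0
  · simp [hc]
  · have hcpos : 0 < ‖c‖ := norm_pos_iff.mpr hc
    have hdpos : 0 < ‖b + a * r‖ := by linarith [norm_nonneg a]
    rw [norm_div, norm_neg, div_le_div_iff₀ hdpos (by norm_num : (0:ℝ) < 2)]
    nlinarith [norm_nonneg a]

/-- Contraction: for `r, r'` in the unit ball the dominated step contracts by `1/8`. -/
theorem cfStep_contraction (a b c r r' : ℂ) (hdom : 2 * (‖a‖ + ‖c‖) ≤ ‖b‖) (hr : ‖r‖ ≤ 1)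
    (hr' : ‖r'‖ ≤ 1) :
    ‖cfStep a b c r - cfStep a b c r'‖ ≤ (1 / 8) * ‖r - r'‖ := by
  unfold cfStep
  have hden := cf_denom_lower a b c r hdom hr
  have hden' := cf_denom_lower a b c r' hdom hr'
  by_cases hc : c = 0
  · simp [hc]
  have hcpos : 0 < ‖c‖ := norm_pos_iff.mpr hc
  have hdpos : 0 < ‖b + a * r‖ := by linarith [norm_nonneg a]
  have hdpos' : 0 < ‖b + a * r'‖ := by linarith [norm_nonneg a]
  have hne : b + a * r ≠ 0 := norm_pos_iff.mp hdpos
  have hne' : b + a * r' ≠ 0 := norm_pos_iff.mp hdpos'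
  have halg : -c / (b + a * r) - -c / (b + a * r') =
      c * (a * (r - r')) / ((b + a * r) * (b + a * r')) := by
    field_simp
    ring
  rw [halg, norm_div, norm_mul, norm_mul, norm_mul]
  rw [div_le_iff₀ (by positivity)]
  -- ‖c‖ (‖a‖ ‖r - r'‖) ≤ 1/8 ‖r - r'‖ (‖b + a r‖ ‖b + a r'‖), using ‖a‖‖c‖ ≤ (‖a‖+2‖c‖)²/8 ≤ D D'/8
  have key : 8 * (‖a‖ * ‖c‖) ≤ ‖b + a * r‖ * ‖b + a * r'‖ := by
    have sq : 8 * (‖a‖ * ‖c‖) ≤ (‖a‖ + 2 * ‖c‖) * (‖a‖ + 2 * ‖c‖) := by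
      nlinarith [sq_nonneg (‖a‖ - 2 * ‖c‖)]
    have := mul_le_mul hden hden' (by positivity) (by positivity)
    linarith
  nlinarith [norm_nonneg (r - r'), key]

/-- Tail control: iterating dominated steps from any two starting values in the unit ball, the results
after `k` steps differ by at most `2 · (1/8)^k`.  (`as, bs, cs` are the coefficient sequences read
from the deep end; `iter k r₀` applies steps `k-1, …, 0`.) -/
theorem cf_tail_bound (as bs cs : ℕ → ℂ) (hdom : ∀ m, 2 * (‖as m‖ + ‖cs m‖) ≤ ‖bs m‖)
    (r₀ r₀' : ℂ) (h0 : ‖r₀‖ ≤ 1) (h0' : ‖r₀'‖ ≤ 1) (k : ℕ) :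
    let iter : ℕ → ℂ → ℂ := fun n x => Nat.rec x (fun m y => cfStep (as m) (bs m) (cs m) y) n
    ‖iter k r₀ - iter k r₀'‖ ≤ 2 * (1 / 8) ^ k := by
  intro iter
  -- both iterates stay in the unit ball, and the distance contracts by 1/8 per step
  have ball : ∀ n x, ‖x‖ ≤ 1 → ‖iter n x‖ ≤ 1 := by
    intro n x hx
    induction n with
    | zero => simpa [iter] using hx
    | succ m ih =>
      show ‖cfStep (as m) (bs m) (cs m) (iter m x)‖ ≤ 1
      exact le_trans (cfStep_norm_le_half _ _ _ _ (hdom m) ih) (by norm_num)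
  induction k with
  | zero =>
    show ‖r₀ - r₀'‖ ≤ 2 * (1 / 8) ^ 0
    calc ‖r₀ - r₀'‖ ≤ ‖r₀‖ + ‖r₀'‖ := norm_sub_le _ _
      _ ≤ 2 * (1 / 8) ^ 0 := by simp; linarith
  | succ m ih =>
    show ‖cfStep (as m) (bs m) (cs m) (iter m r₀) - cfStep (as m) (bs m) (cs m) (iter m r₀')‖ ≤
      2 * (1 / 8) ^ (m + 1)
    have hc := cfStep_contraction (as m) (bs m) (cs m) (iter m r₀) (iter m r₀') (hdom m)
      (ball m r₀ h0) (ball m r₀' h0')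
    calc _ ≤ (1 / 8) * ‖iter m r₀ - iter m r₀'‖ := hc
      _ ≤ (1 / 8) * (2 * (1 / 8) ^ m) := by gcongr
      _ = 2 * (1 / 8) ^ (m + 1) := by ring

end Summit.AnomalousDissipation.AnomalousDissipation.Theorems
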